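import Summits.Schanuel.Schanuel.Theses.RootDecomp1E
import Summits.Schanuel.Schanuel.Theorems.RootDecomp1DefectSplit
import Literature.NumberTheory.Transcendental.SchanuelEclEmptyProofs
import Literature.NumberTheory.Transcendental.LindemannWeierstrassProofs

/-!
# RootDecomp1E — DarkAnchor, corank-one rung (bc5 witness for the round-4 residual `AnchoredDarkAtomSchanuel`, stmt-Schanuel-28355)

Port (census seat, prover role) of the kernel rungs of lens-2 g4's node «DarkAnchor»
(`HOME/decomp-schanuel-lens-2/g4/DarkAnchor.lean` 2001bedf…, critic CLEARED 2026-08-30T05:04:49Z; hand-off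
`prover/DarkAnchorCorankOne.port.lean`), made DEFINITION-FREE: every lemma is stated for an ARBITRARY intermediate
field `L ≤ ℂ` that is closed under `exp` and relatively algebraically closed in `ℂ` (the two properties of the
closed-form field 𝕃 the argument uses), and the item-shaped theorem instantiates `L := 𝕃 = sInf {K : exp K ⊆ K,
exp⁻¹ K ⊆ K, K relatively algebraically closed}` exactly as the route items 27517/27518/28355/28356 inline it.

* `anchored_corank_one` — a ℚ-independent SPAN-MINIMAL `z : Fin n → ℂ` with a coordinate outside `L` whose span
  contains `n − 1` independent vectors of `L` satisfies Schanuel (no saturation, no S⁻): the whole corank-one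
  layer of `AnchoredDarkAtomSchanuel` is a theorem;
* `anchoredDarkAtomSchanuel_le_two` — hence item 28355's text with `n ≤ 2` inserted holds outright;
* `two_le_trdeg_of_mem_of_not_mem`, `exp_fixedPoint_dichotomy`, `lambertW_dichotomy` — unconditional dichotomies:
  a fixed point `ζ = e^ζ` (resp. `Ω e^Ω = 1`) lies in `L` or is algebraically independent of `e`.
Toolkit lemmas are imported from the tree (`RootDecomp1DefectSplit.trdeg_adjoin_le_of_isAlgebraic`,
`SchanuelEclEmptyProofs.exists_nsmul_mem_span_int` / `mem_adjoin_of_mem_span_int`, Hermite–Lindemann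
`transcendental_exp_holds`).  0 sorry.
-/

set_option linter.dupNamespace false

noncomputable section

namespace Summit.Schanuel.Schanuel.Theorems.RootDecomp1EDarkAnchorCorankOne

open Complex IntermediateField
open Literature.NumberTheory.Transcendental (exists_nsmul_mem_span_int mem_adjoin_of_mem_span_int)
open Summit.Schanuel.Schanuel.Theorems.RootDecomp1DefectSplit (trdeg_adjoin_le_of_isAlgebraic isAlgebraic_of_mem_gens)

/-! ## Toolkit -/

/-- Elements of a generated field are algebraic over it. -/
theorem isAlgebraic_of_mem_adjoin {S : Set ℂ} {x : ℂ} (hx : x ∈ adjoin ℚ S) :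
    IsAlgebraic ↥(adjoin ℚ S) x :=
  isAlgebraic_algebraMap (⟨x, hx⟩ : ↥(adjoin ℚ S))

/-- Algebraicity passes up along an inclusion of subfields of ℂ. -/
theorem isAlgebraic_of_le {E₁ E₂ : IntermediateField ℚ ℂ} (hle : E₁ ≤ E₂) {x : ℂ}
    (hx : IsAlgebraic ↥E₁ x) : IsAlgebraic ↥E₂ x := by
  obtain ⟨p, hp0, hpx⟩ := hx
  have hf : Function.Injective (IntermediateField.inclusion hle).toRingHom :=
    IntermediateField.inclusion_injective hle
  refine ⟨p.map (IntermediateField.inclusion hle).toRingHom, ?_, ?_⟩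
  · simpa using (Polynomial.map_injective _ hf).ne hp0
  · rw [Polynomial.aeval_def, Polynomial.eval₂_map]
    have : (algebraMap (↥E₂) ℂ).comp (IntermediateField.inclusion hle).toRingHom =
        algebraMap (↥E₁) ℂ := RingHom.ext fun _ => rfl
    rw [this]
    rwa [Polynomial.aeval_def] at hpx

/-- A cardinal below a natural number is a natural number. -/
theorem exists_nat_eq_of_lt_natCast {c : Cardinal} {n : ℕ} (h : c < (n : Cardinal)) :
    ∃ t : ℕ, c = t ∧ t < n := by
  obtain ⟨t, rfl⟩ := Cardinal.lt_aleph0.mp (h.trans (Cardinal.natCast_lt_aleph0))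
  exact ⟨t, rfl, by exact_mod_cast h⟩

set_option synthInstance.maxHeartbeats 200000 in
/-- EQUAL TRANSCENDENCE DEGREE FORCES ALGEBRAICITY: if `S ⊆ T`, `trdeg ℚ(T) ≤ t ≤ trdeg ℚ(S)` with
`t` finite, then every element of `ℚ(T)` is algebraic over `ℚ(S)`. [folklore] -/
theorem isAlgebraic_of_trdeg_le {S T : Set ℂ} (hST : S ⊆ T) {t : ℕ}
    (hT : Algebra.trdeg ℚ ↥(adjoin ℚ T) ≤ (t : Cardinal))
    (hS : (t : Cardinal) ≤ Algebra.trdeg ℚ ↥(adjoin ℚ S)) {x : ℂ} (hx : x ∈ adjoin ℚ T) :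
    IsAlgebraic ↥(adjoin ℚ S) x := by
  by_contra hxt
  have h1 : (1 : Cardinal) ≤
      Algebra.trdeg ↥(adjoin ℚ S) ↥(adjoin (↥(adjoin ℚ S)) ({x} : Set ℂ)) := by
    haveI : Algebra.Transcendental ↥(adjoin ℚ S) ↥(adjoin (↥(adjoin ℚ S)) ({x} : Set ℂ)) :=
      ⟨⟨⟨x, mem_adjoin_simple_self (↥(adjoin ℚ S)) x⟩,
        fun h => hxt (IntermediateField.isAlgebraic_iff.mp h)⟩⟩
    exact Cardinal.one_le_iff_pos.mpr (trdeg_pos ↥(adjoin ℚ S) ↥(adjoin (↥(adjoin ℚ S)) ({x} : Set ℂ)))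
  -- tower law along `K ⊆ K(S) ⊆ K(S)(T) = K(S ∪ T)` (generic in `K` to dodge the `ℚ`-algebra instance diamond)
  have tower : ∀ {K E : Type} [Field K] [Field E] [Algebra K E] (S T : Set E),
      Algebra.trdeg K ↥(adjoin K S) + Algebra.trdeg ↥(adjoin K S) ↥(adjoin (↥(adjoin K S)) T) =
        Algebra.trdeg K ↥(adjoin K (S ∪ T)) := by
    intro K E _ _ _ S T
    haveI : FaithfulSMul (adjoin K S) (adjoin (adjoin K S) T) :=
      ⟨fun {m₁ m₂} h => (algebraMap (adjoin K S) (adjoin (adjoin K S) T)).injective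
        (by simpa [Algebra.smul_def] using h 1)⟩
    have htower := trdeg_add_eq K (adjoin K S) (A := adjoin (adjoin K S) T)
    have heq : Algebra.trdeg K (adjoin (adjoin K S) T) = Algebra.trdeg K (adjoin K (S ∪ T)) := by
      rw [← (equivOfEq (adjoin_adjoin_left K S T)).trdeg_eq]
      rfl
    rw [htower, heq]
  have h2 : Algebra.trdeg ℚ ↥(adjoin ℚ S) + Algebra.trdeg ↥(adjoin ℚ S) ↥(adjoin (↥(adjoin ℚ S)) ({x} : Set ℂ)) =
      Algebra.trdeg ℚ ↥(adjoin ℚ (S ∪ {x})) := by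
    exact tower (K := ℚ) S ({x} : Set ℂ)
  have h3 : adjoin ℚ (S ∪ {x}) ≤ adjoin ℚ T :=
    adjoin_le_iff.mpr (Set.union_subset (hST.trans (subset_adjoin ℚ T))
      (Set.singleton_subset_iff.mpr hx))
  have h4 : Algebra.trdeg ℚ ↥(adjoin ℚ (S ∪ {x})) ≤ (t : Cardinal) :=
    (trdeg_le_of_injective (inclusion h3) (inclusion_injective h3)).trans hT
  have h5 : (t : Cardinal) + 1 ≤ (t : Cardinal) := (add_le_add hS h1).trans (h2.le.trans h4)
  have h6 : ((t + 1 : ℕ) : Cardinal) ≤ (t : Cardinal) := by push_cast; exact h5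
  have h7 : t + 1 ≤ t := by exact_mod_cast h6
  omega

/-- HERMITE–LINDEMANN as a defect floor: a family with a non-zero member has `trdeg ℚ(z, e^z) ≥ 1`
(tree theorem `transcendental_exp_holds`). -/
theorem one_le_trdeg_of_ne_zero {ι : Type*} (z : ι → ℂ) (i : ι) (hzi : z i ≠ 0) :
    (1 : Cardinal) ≤ Algebra.trdeg ℚ ↥(adjoin ℚ (Set.range z ∪ Set.range (cexp ∘ z))) := by
  set K := adjoin ℚ (Set.range z ∪ Set.range (cexp ∘ z)) with hK
  have hzK : z i ∈ K := subset_adjoin ℚ _ (Or.inl ⟨i, rfl⟩)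
  have heK : cexp (z i) ∈ K := subset_adjoin ℚ _ (Or.inr ⟨i, rfl⟩)
  have ht : ∃ t : K, Transcendental ℚ t := by
    by_cases halg : IsAlgebraic ℚ (z i)
    · exact ⟨⟨_, heK⟩, fun h =>
        Literature.NumberTheory.Transcendental.transcendental_exp_holds halg hzi
          (IntermediateField.isAlgebraic_iff.mp h)⟩
    · exact ⟨⟨_, hzK⟩, fun h => halg (IntermediateField.isAlgebraic_iff.mp h)⟩
  obtain ⟨t, ht⟩ := ht
  haveI : Algebra.Transcendental ℚ K := ⟨⟨t, ht⟩⟩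
  exact Cardinal.one_le_iff_pos.mpr (trdeg_pos ℚ K)

/-- `span_ℚ z ⊆ F_z`. -/
theorem mem_adjoin_of_mem_span {n : ℕ} {z : Fin n → ℂ} {x : ℂ}
    (hx : x ∈ Submodule.span ℚ (Set.range z)) :
    x ∈ adjoin ℚ (Set.range z ∪ Set.range (cexp ∘ z)) := by
  have hle : Submodule.span ℚ (Set.range z) ≤
      (adjoin ℚ (Set.range z ∪ Set.range (cexp ∘ z))).toSubalgebra.toSubmodule := by
    rw [Submodule.span_le]
    rintro _ ⟨i, rfl⟩
    exact subset_adjoin ℚ _ (Or.inl ⟨i, rfl⟩)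
  exact hle hx

/-- EXPONENTIALS OF THE SPAN ARE ALGEBRAIC OVER `F_z` (a positive multiple `N v` lies in the ℤ-span, so
`(e^v)^N ∈ F_z`). -/
theorem exp_isAlgebraic_of_mem_span {n : ℕ} {z : Fin n → ℂ} {v : ℂ}
    (hv : v ∈ Submodule.span ℚ (Set.range z)) :
    IsAlgebraic ↥(adjoin ℚ (Set.range z ∪ Set.range (cexp ∘ z))) (cexp v) := by
  obtain ⟨N, hN, hNv⟩ := exists_nsmul_mem_span_int z hv
  have hmem := (mem_adjoin_of_mem_span_int z hNv).2
  have hpow : cexp ((N : ℚ) • v) = cexp v ^ N := by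
    rw [Nat.cast_smul_eq_nsmul, nsmul_eq_mul, Complex.exp_nat_mul]
  rw [hpow] at hmem
  exact IsAlgebraic.of_pow (Nat.pos_of_ne_zero hN) (isAlgebraic_of_mem_adjoin hmem)

/-! ## Rungs over an arbitrary exp-closed, relatively algebraically closed subfield `L ≤ ℂ` -/

section AnyL

variable (L : IntermediateField ℚ ℂ) (hLexp : ∀ w ∈ L, cexp w ∈ L)
  (hLalg : ∀ w : ℂ, IsAlgebraic ↥L w → w ∈ L)
include hLexp in
/-- The field generated by a tuple from `L` and its exponentials is inside `L`. -/
theorem adjoin_le_of_mem {m : ℕ} {w : Fin m → ℂ} (hw : ∀ j, w j ∈ L) :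
    adjoin ℚ (Set.range w ∪ Set.range (cexp ∘ w)) ≤ L := by
  rw [adjoin_le_iff]
  rintro x (⟨j, rfl⟩ | ⟨j, rfl⟩)
  · exact hw j
  · exact hLexp _ (hw j)

include hLexp hLalg in
/-- **anchored_corank_one.**  Let `z` be ℚ-independent of length `n`, with a coordinate outside `L`, SPAN-MINIMAL,
and suppose `span_ℚ z` contains `n − 1` ℚ-independent vectors `w` of `L` (corank one).  Then `n ≤ trdeg ℚ(z, e^z)` —
unconditionally.  (Span-minimality gives `n − 1 ≤ trdeg F_w`; `F_w ≤ L`; the generators of `F_w` are algebraic over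
`F_z`; if `trdeg F_z ≤ n − 1` then the outside coordinate would be algebraic over `F_w ≤ L`, hence in `L`.) -/
theorem anchored_corank_one (n : ℕ) (z : Fin n → ℂ) (hd : ∃ i, z i ∉ L)
    (hw : ∃ (m : ℕ) (w : Fin m → ℂ), m + 1 = n ∧ LinearIndependent ℚ w ∧
      ∀ j, w j ∈ Submodule.span ℚ (Set.range z) ∧ w j ∈ L)
    (hmin : ∀ (m : ℕ) (w : Fin m → ℂ), m < n → LinearIndependent ℚ w →
      (∀ j, w j ∈ Submodule.span ℚ (Set.range z)) →
      (m : Cardinal) ≤ Algebra.trdeg ℚ ↥(adjoin ℚ (Set.range w ∪ Set.range (cexp ∘ w)))) :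
    (n : Cardinal) ≤ Algebra.trdeg ℚ ↥(adjoin ℚ (Set.range z ∪ Set.range (cexp ∘ z))) := by
  classical
  obtain ⟨i, hi⟩ := hd
  obtain ⟨m, w, rfl, hwli, hwmem⟩ := hw
  set Kw : IntermediateField ℚ ℂ := adjoin ℚ (Set.range w ∪ Set.range (cexp ∘ w)) with hKw
  set Kz : IntermediateField ℚ ℂ := adjoin ℚ (Set.range z ∪ Set.range (cexp ∘ z)) with hKz
  have hTw_ge : (m : Cardinal) ≤ Algebra.trdeg ℚ ↥Kw :=
    hmin m w (Nat.lt_succ_self m) hwli fun j => (hwmem j).1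
  by_contra hlt
  rw [not_le] at hlt
  obtain ⟨t, ht, htm⟩ := exists_nat_eq_of_lt_natCast hlt
  have hTz_le : Algebra.trdeg ℚ ↥Kz ≤ (m : Cardinal) := by
    rw [ht]
    exact_mod_cast Nat.lt_succ_iff.mp htm
  have hgen : ∀ x ∈ (Set.range w ∪ Set.range (cexp ∘ w)) ∪ (Set.range z ∪ Set.range (cexp ∘ z)),
      IsAlgebraic ↥Kz x := by
    rintro x ((⟨j, rfl⟩ | ⟨j, rfl⟩) | hx)
    · exact isAlgebraic_of_mem_adjoin (mem_adjoin_of_mem_span (hwmem j).1)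
    · exact exp_isAlgebraic_of_mem_span (hwmem j).1
    · exact isAlgebraic_of_mem_gens hx
  have hT_le : Algebra.trdeg ℚ ↥(adjoin ℚ ((Set.range w ∪ Set.range (cexp ∘ w)) ∪
      (Set.range z ∪ Set.range (cexp ∘ z)))) ≤ (m : Cardinal) :=
    (trdeg_adjoin_le_of_isAlgebraic Kz hgen).trans hTz_le
  have hzi_alg : IsAlgebraic ↥Kw (z i) :=
    isAlgebraic_of_trdeg_le Set.subset_union_left hT_le hTw_ge
      (subset_adjoin ℚ _ (Or.inr (Or.inl ⟨i, rfl⟩)))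
  have hKwL : Kw ≤ L := adjoin_le_of_mem L hLexp fun j => (hwmem j).2
  exact hi (hLalg _ (isAlgebraic_of_le hKwL hzi_alg))

include hLexp hLalg in
/-- ADK's `n ≤ 2` layer over `L`: a ℚ-independent span-minimal tuple of length `≤ 2` with a coordinate outside `L`
and a non-zero vector of `L` in its span satisfies Schanuel. -/
theorem anchored_of_le_two (n : ℕ) (hn : n ≤ 2) (z : Fin n → ℂ) (hz : LinearIndependent ℚ z)
    (hd : ∃ i, z i ∉ L) (han : ∃ x ∈ Submodule.span ℚ (Set.range z), x ≠ 0 ∧ x ∈ L)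
    (hmin : ∀ (m : ℕ) (w : Fin m → ℂ), m < n → LinearIndependent ℚ w →
      (∀ j, w j ∈ Submodule.span ℚ (Set.range z)) →
      (m : Cardinal) ≤ Algebra.trdeg ℚ ↥(adjoin ℚ (Set.range w ∪ Set.range (cexp ∘ w)))) :
    (n : Cardinal) ≤ Algebra.trdeg ℚ ↥(adjoin ℚ (Set.range z ∪ Set.range (cexp ∘ z))) := by
  obtain ⟨x, hxspan, hx0, hxL⟩ := han
  rcases n with _ | _ | _ | n
  · simp
  · exact anchored_corank_one L hLexp hLalg 1 z hd ⟨0, Fin.elim0, rfl, linearIndependent_empty_type,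
      fun j => j.elim0⟩ hmin
  · refine anchored_corank_one L hLexp hLalg 2 z hd ⟨1, fun _ => x, rfl, ?_, fun _ => ⟨hxspan, hxL⟩⟩ hmin
    have _ := hz
    exact linearIndependent_unique_iff.mpr hx0
  · omega

/-- The pair `(c, u)` with `c ∈ L ∖ {0}` and `u ∉ L` is ℚ-independent. -/
theorem linearIndependent_pair {c u : ℂ} (hc : c ∈ L) (hc0 : c ≠ 0) (hu : u ∉ L) :
    LinearIndependent ℚ ![c, u] := by
  rw [LinearIndependent.pair_iff]
  intro s t hst
  by_cases ht : t = 0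
  · subst ht
    simp only [zero_smul, add_zero, smul_eq_zero] at hst
    exact ⟨hst.resolve_right hc0, rfl⟩
  · exfalso
    apply hu
    have hu_eq : u = -(t⁻¹ * s) • c := by
      have h1 : t • u = -(s • c) := eq_neg_of_add_eq_zero_right hst
      calc u = t⁻¹ • (t • u) := by rw [smul_smul, inv_mul_cancel₀ ht, one_smul]
        _ = -(t⁻¹ * s) • c := by rw [h1, smul_neg, smul_smul, neg_smul]
    rw [hu_eq]
    exact L.smul_mem hc

/-- Every pair is SPAN-MINIMAL: every non-zero `x` has `trdeg ℚ(x, e^x) ≥ 1` (Hermite–Lindemann). -/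
theorem spanMinimal_two (z : Fin 2 → ℂ) :
    ∀ (m : ℕ) (w : Fin m → ℂ), m < 2 → LinearIndependent ℚ w →
      (∀ j, w j ∈ Submodule.span ℚ (Set.range z)) →
      (m : Cardinal) ≤ Algebra.trdeg ℚ ↥(adjoin ℚ (Set.range w ∪ Set.range (cexp ∘ w))) := by
  intro m w hm hw _
  rcases m with _ | _ | m
  · simp
  · have h := one_le_trdeg_of_ne_zero w 0 (hw.ne_zero 0)
    exact_mod_cast h
  · omega

include hLexp hLalg in
/-- For `c ∈ L`, `c ≠ 0`, `u ∉ L`: `2 ≤ trdeg ℚ(c, u, e^c, e^u)` — unconditionally. -/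
theorem two_le_trdeg_of_mem_of_not_mem {c u : ℂ} (hc : c ∈ L) (hc0 : c ≠ 0) (hu : u ∉ L) :
    (2 : Cardinal) ≤ Algebra.trdeg ℚ ↥(adjoin ℚ (Set.range ![c, u] ∪ Set.range (cexp ∘ ![c, u]))) := by
  have hd : ∃ i, (![c, u] : Fin 2 → ℂ) i ∉ L := ⟨1, by simpa using hu⟩
  have hw : ∃ (m : ℕ) (w : Fin m → ℂ), m + 1 = 2 ∧ LinearIndependent ℚ w ∧
      ∀ j, w j ∈ Submodule.span ℚ (Set.range ![c, u]) ∧ w j ∈ L :=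
    ⟨1, fun _ => c, rfl, linearIndependent_unique_iff.mpr hc0,
      fun _ => ⟨Submodule.subset_span ⟨0, by simp⟩, hc⟩⟩
  exact_mod_cast anchored_corank_one L hLexp hLalg 2 ![c, u] hd hw (spanMinimal_two _)

include hLexp hLalg in
/-- With the anchor `c = 1`: for `u ∉ L` with `e^u ∈ ℚ(e, u)`, `2 ≤ trdeg ℚ(e, u)`. -/
theorem two_le_trdeg_exp_one_pair {u : ℂ} (hu : u ∉ L) (heu : cexp u ∈ adjoin ℚ ({cexp 1, u} : Set ℂ)) :
    (2 : Cardinal) ≤ Algebra.trdeg ℚ ↥(adjoin ℚ ({cexp 1, u} : Set ℂ)) := by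
  refine (two_le_trdeg_of_mem_of_not_mem L hLexp hLalg (one_mem _) one_ne_zero hu).trans
    (trdeg_adjoin_le_of_isAlgebraic _ ?_)
  rintro x (⟨i, rfl⟩ | ⟨i, rfl⟩)
  · refine Fin.cases ?_ (fun j => ?_) i
    · simpa using isAlgebraic_one
    · have hj : j = 0 := Subsingleton.elim j 0
      subst hj
      simpa using isAlgebraic_of_mem_gens (S := ({cexp 1, u} : Set ℂ)) (Or.inr rfl)
  · refine Fin.cases ?_ (fun j => ?_) i
    · simpa using isAlgebraic_of_mem_gens (S := ({cexp 1, u} : Set ℂ)) (Or.inl rfl)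
    · have hj : j = 0 := Subsingleton.elim j 0
      subst hj
      simpa using isAlgebraic_of_mem_adjoin heu

include hLexp hLalg in
/-- **exp_fixedPoint_dichotomy.**  Every fixed point `ζ = e^ζ` of `exp` lies in `L` or is algebraically independent of
`e` (`trdeg ℚ(e, ζ) = 2`). -/
theorem exp_fixedPoint_dichotomy (ζ : ℂ) (hζ : cexp ζ = ζ) :
    ζ ∈ L ∨ (2 : Cardinal) ≤ Algebra.trdeg ℚ ↥(adjoin ℚ ({cexp 1, ζ} : Set ℂ)) := by
  by_cases h : ζ ∈ L
  · exact Or.inl h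
  · refine Or.inr (two_le_trdeg_exp_one_pair L hLexp hLalg h ?_)
    rw [hζ]
    exact subset_adjoin ℚ _ (Or.inr rfl)

include hLexp hLalg in
/-- **lambertW_dichotomy.**  Every `Ω` with `Ω e^Ω = 1` (e.g. `Ω = W(1)`) lies in `L` or is algebraically independent of `e`. -/
theorem lambertW_dichotomy (Ω : ℂ) (hΩ : Ω * cexp Ω = 1) :
    Ω ∈ L ∨ (2 : Cardinal) ≤ Algebra.trdeg ℚ ↥(adjoin ℚ ({cexp 1, Ω} : Set ℂ)) := by
  by_cases h : Ω ∈ L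
  · exact Or.inl h
  · refine Or.inr (two_le_trdeg_exp_one_pair L hLexp hLalg h ?_)
    have hΩ0 : Ω ≠ 0 := by rintro rfl; simp at hΩ
    have : cexp Ω = Ω⁻¹ :=
      calc cexp Ω = Ω⁻¹ * (Ω * cexp Ω) := by rw [← mul_assoc, inv_mul_cancel₀ hΩ0, one_mul]
        _ = Ω⁻¹ := by rw [hΩ, mul_one]
    rw [this]
    exact inv_mem (subset_adjoin ℚ _ (Or.inr rfl))

end AnyL

/-! ## The closed-form field 𝕃 of the route items (the inlined `sInf`) has the two properties -/

/-- 𝕃 is closed under `exp`. -/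
theorem exp_mem_sInf {x : ℂ} (hx : x ∈ (sInf {K : IntermediateField ℚ ℂ | (∀ w ∈ K, Complex.exp w ∈ K) ∧
      (∀ w : ℂ, Complex.exp w ∈ K → w ∈ K) ∧ ∀ w : ℂ, IsAlgebraic K w → w ∈ K} : IntermediateField ℚ ℂ)) :
    cexp x ∈ (sInf {K : IntermediateField ℚ ℂ | (∀ w ∈ K, Complex.exp w ∈ K) ∧
      (∀ w : ℂ, Complex.exp w ∈ K → w ∈ K) ∧ ∀ w : ℂ, IsAlgebraic K w → w ∈ K} : IntermediateField ℚ ℂ) := by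
  rw [IntermediateField.mem_sInf] at hx ⊢
  exact fun K hK => hK.1 x (hx K hK)

/-- 𝕃 is relatively algebraically closed in ℂ. -/
theorem mem_sInf_of_isAlgebraic {x : ℂ}
    (hx : IsAlgebraic ↥(sInf {K : IntermediateField ℚ ℂ | (∀ w ∈ K, Complex.exp w ∈ K) ∧
      (∀ w : ℂ, Complex.exp w ∈ K → w ∈ K) ∧ ∀ w : ℂ, IsAlgebraic K w → w ∈ K} : IntermediateField ℚ ℂ) x) :
    x ∈ (sInf {K : IntermediateField ℚ ℂ | (∀ w ∈ K, Complex.exp w ∈ K) ∧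
      (∀ w : ℂ, Complex.exp w ∈ K → w ∈ K) ∧ ∀ w : ℂ, IsAlgebraic K w → w ∈ K} : IntermediateField ℚ ℂ) := by
  rw [IntermediateField.mem_sInf]
  intro K hK
  exact hK.2.2 x (isAlgebraic_of_le (sInf_le hK) hx)

/-! ## The witness in item shape: `AnchoredDarkAtomSchanuel` (stmt-Schanuel-28355) restricted to `n ≤ 2`, hypotheses verbatim -/

/-- Item 28355's text with `n ≤ 2` inserted: the first two lengths of the round-4 residual are a THEOREM. -/
theorem anchoredDarkAtomSchanuel_le_two :
    ∀ (n : ℕ), n ≤ 2 → ∀ (z : Fin n → ℂ), LinearIndependent ℚ z → (∃ i, z i ∉ (sInf {K : IntermediateField ℚ ℂ | (∀ w ∈ K, Complex.exp w ∈ K) ∧ (∀ w : ℂ, Complex.exp w ∈ K → w ∈ K) ∧ ∀ w : ℂ, IsAlgebraic K w → w ∈ K} : IntermediateField ℚ ℂ)) → (∃ x ∈ Submodule.span ℚ (Set.range z), x ≠ 0 ∧ x ∈ (sInf {K : IntermediateField ℚ ℂ | (∀ w ∈ K, Complex.exp w ∈ K) ∧ (∀ w : ℂ, Complex.exp w ∈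 K → w ∈ K) ∧ ∀ w : ℂ, IsAlgebraic K w → w ∈ K} : IntermediateField ℚ ℂ)) → (∀ (m : ℕ) (w : Fin m → ℂ), m < n → LinearIndependent ℚ w → (∀ j, w j ∈ Submodule.span ℚ (Set.range z)) → (m : Cardinal) ≤ Algebra.trdeg ℚ ↥(IntermediateField.adjoin ℚ (Set.range w ∪ Set.range (Complex.exp ∘ w)))) → (∀ v : ℂ, IsAlgebraic ↥(IntermediateField.adjoin ℚ (Set.range z ∪ Set.range (Complex.exp ∘ z))) v → IsAlgebraic ↥(IntermediateField.adjoin ℚ (Set.range z ∪ Set.range (Complex.exp ∘ z))) (Complex.exp v) → v ∈ Submodule.span ℚ (Set.range z)) → (n : Cardinal) ≤ Algebra.trdeg ℚ ↥(IntermediateField.adjoin ℚ (Set.range z ∪ Set.range (Complex.exp ∘ z))) :=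
  fun n hn z hz hd han hmin _ =>
    anchored_of_le_two _ (fun _ hw => exp_mem_sInf hw) (fun _ hw => mem_sInf_of_isAlgebraic hw) n hn z hz hd han hmin

end Summit.Schanuel.Schanuel.Theorems.RootDecomp1EDarkAnchorCorankOne

end
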